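import Summits.QuantumFields.BalabanUV.Beta.GAN24.DerivativeRateTransferLoewnerGram
import Summits.QuantumFields.BalabanUV.Beta.GAN24.DerivativeRateTransferLoewnerEnd

/-!
# `BalabanUV.Beta.GAN24.DerivativeRateTransferLoewnerGramEnd` — binder row G-an2-4 ∕ (CONV-C), route R6 «VALUES, NOT DERIVATIVES», PART 23:
# THE CAPSTONE UNDER THE GRAM SLACK — an1's `dEffForm` rows along a real affine two-bond tower ⇐ (STAB-ε,δ) + (CONS) + S2 + the k-uniform
# `G`-mass `N` of the unit-source minimisers; and the PARAMETER CHOICE that turns PART 22's Peter–Paul family (every `t > 0`) with a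
# geometrically small holonomy defect `κ_j² ≤ cK·θ^{2j}` into (STAB-ε_j,δ_j) with `ε_j = θ^j`, `δ_j = 2cK·θ^j` (unit b2b-balaban-gan24-p3, gen 37; v1)

NOT IN PRINT; OUR PROOF (for the ROUTE; [folklore] — PART 20 `effForm_entry_step_rate_of_stabGram_of_cons` + PART 19's realification letters
(`effForm_affine₂_ofReal`, `isUnit_det_kkt_affine₂_real`) + PART 13 `dEffForm_step_rateω` BY NAME).  HONEST FRAMING (cell contract, verbatim): «discharging
`BetaPertH` makes Bałaban's UV stability UNCONDITIONAL — a real constructive-QFT result; it is NOT the continuum limit and NOT the Clay problem.»  HONEST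
DEPENDENCY (verbatim): «continuum YM on T⁴ ⇐ BetaPertH ∧ nine spine estimates (0/9 proved); BetaPertH ⇐ (D1) ∧ (D4) ∧ CAP+tail; G-an2-4 gates asym, D1
and NE2/3/4.»

WHY THIS FILE.  PART 22 proves, for transported block averagings of colour site fields, the family `Qᵀ H_c Q ≤ (1+t)·H_f + ((1+t⁻¹)·K)·1` for EVERY
`t > 0` (`K = κ²·w_c·g`, `κ` the loop-holonomy defect); PART 20 consumes ONE inequality per level, (STAB-ε_j,δ_j) with `ε_j = cε·θ^j`, `δ_j = cδ·θ^j`; PART 19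
is the capstone under PART 18's (STAB) ∕ (STAB-ε).  §1 is the junction PART 22 → PART 20: with a mass form `G ≥ 0` and a defect `K ≤ cK·τ²` (`0 < τ ≤ 1`,
`τ = θ^j`: the curvature seen by a level-`j` block loop is `O(η_j²)`, so `κ_j² = O(θ^{2j})`), the choice `t = τ` gives `(1+τ)·H′ + (2cK·τ)·G`.  §2 is PART 19
§4 with the Gram slack: the real entry rate `(cst + 2cε·B + 2cδ·N)·θ^k` from PART 20, realified, fed to PART 13 — an1's first B-jet rows with NO value rate
assumed and (STAB) only in its honest with-curvature shape.

WHAT THIS FILE PROVES (0 sorry, 0 `def`, nothing cited):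
* §1 `posSemidef_add_smul_of_le` (enlarging the coefficient of a PSD summand keeps PSD), **`stabGram_of_family`** (the `t = τ` choice:
  `∀ t > 0, 0 ≤ (1+t)H′ + ((1+t⁻¹)K)G − QfᵀHQf`, `G ≥ 0`, `0 ≤ K ≤ cK·τ²`, `0 < τ ≤ 1` ⟹ `0 ≤ (1+τ)H′ + (2cK·τ)G − QfᵀHQf`).
* §2 **`effForm_affine₂_step_rate_of_stabGram_of_cons`** ((S1) PRODUCED under (STAB-ε,δ): real affine two-bond towers, at every real `(s,t) ∈ [0,s₁]²` PSD
  fine forms, `Q_{k+1} = Q_k·Qf_k`, `Q_{k+1}·P_k = Q_k`, symmetric mass forms `G_k(s,t)`, (STAB-ε_k,δ_k), (CONS) `≤ cst·θ^k`, `|(ℋ_kᵀG_kℋ_k)_{ab}| ≤ N`; S2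
  (complexified bordered matrices nonsingular with `‖𝒮‖ ≤ B` on the bidisc) ⟹ value rate `(cst + 2cε·B + 2cδ·N)·θ^k` on the real square),
  **`dEffForm_step_rateω_of_stabGram_of_cons`** (⟹ `‖dEffForm_{k+1} − dEffForm_k‖ ≤ 25·(2B)^r∕(s₁r²)·(cst + 2cεB + 2cδN)^{1−r}·(θ^{1−r})^k`).
WHAT IT DOES NOT DO: produce the tower data, `κ_j`, `N`, S2 or S2(ii) for any of Bałaban's operators.  SUPPLIER work on route R6 (rank 2, REDUCTION, no
seat); no consumer of record; NEVER «G-an2-4 closed»; NOT (CONV-C), NOT D1, NOT `BetaPertH`, NOT continuum, NOT Clay.  Records: `HOME/b2b-balaban-gan24-p3/WOODBURY-FIBRE.md` v13.7.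
-/

noncomputable section

open Set Metric Matrix

namespace Summit.QuantumFields.BalabanUV.Beta.GAN24.DerivativeRateTransferLoewnerGramEnd

open Literature.MathematicalPhysics.QuantumFieldTheory.Balaban1983to89.Beta.Composition (kkt)
open Literature.MathematicalPhysics.QuantumFieldTheory.Balaban1983to89.Beta.CompositionSingular (effForm minOp)
open Literature.MathematicalPhysics.QuantumFieldTheory.Balaban1983to89.Beta.BorderedJets (dEffForm)
open Summit.QuantumFields.BalabanUV.Beta.GAN24.DerivativeRateTransferAnalyticKKTEnd (dEffForm_step_rateω)
open Summit.QuantumFields.BalabanUV.Beta.GAN24.DerivativeRateTransferLoewnerGram (effForm_entry_step_rate_of_stabGram_of_cons)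
open Summit.QuantumFields.BalabanUV.Beta.GAN24.DerivativeRateTransferLoewnerEnd (effForm_affine₂_ofReal isUnit_det_kkt_affine₂_real)

/-! ## §1 The junction PART 22 → PART 20: choosing the Peter–Paul parameter -/

section Choice

variable {ν ν' : Type*} [Fintype ν]
variable {H : Matrix ν ν ℝ} {H' G : Matrix ν' ν' ℝ} {Qf : Matrix ν ν' ℝ}

/-- [folklore] enlarging the coefficient of a PSD summand keeps a matrix PSD: `0 ≤ X + c₁•G`, `0 ≤ G`, `c₁ ≤ c₂` ⟹ `0 ≤ X + c₂•G`. -/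
theorem posSemidef_add_smul_of_le {X : Matrix ν' ν' ℝ} {c₁ c₂ : ℝ} (hX : (X + c₁ • G).PosSemidef) (hG : G.PosSemidef) (hc : c₁ ≤ c₂) :
    (X + c₂ • G).PosSemidef := by
  have h := hX.add (hG.smul (sub_nonneg.mpr hc))
  have e : X + c₁ • G + (c₂ - c₁) • G = X + c₂ • G := by rw [add_assoc, ← add_smul]; congr 2; ring
  rwa [e] at h

/-- **`stabGram_of_family` — THE `t = τ` CHOICE** [our proof]: if `0 ≤ (1+t)•H′ + ((1+t⁻¹)·K)•G − QfᵀHQf` for EVERY `t > 0` (PART 22's shape, `G = 1` there),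
`G ≥ 0`, `0 ≤ K ≤ cK·τ²` and `0 < τ ≤ 1`, then `0 ≤ (1+τ)•H′ + (2cK·τ)•G − QfᵀHQf` — (STAB-ε,δ) with `ε = τ`, `δ = 2cK·τ` (at level `j`: `τ = θ^j`). -/
theorem stabGram_of_family {K cK τ : ℝ}
    (hfam : ∀ t : ℝ, 0 < t → ((1 + t) • H' + ((1 + t⁻¹) * K) • G - Qfᵀ * H * Qf).PosSemidef)
    (hG : G.PosSemidef) (hK0 : 0 ≤ K) (hK : K ≤ cK * τ ^ 2) (hτ : 0 < τ) (hτ1 : τ ≤ 1) :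
    ((1 + τ) • H' + (2 * cK * τ) • G - Qfᵀ * H * Qf).PosSemidef := by
  have h := hfam τ hτ
  have hle : (1 + τ⁻¹) * K ≤ 2 * cK * τ := by
    have hcK : 0 ≤ cK * τ ^ 2 := hK0.trans hK
    have h1 : (1 + τ⁻¹) * K ≤ (1 + τ⁻¹) * (cK * τ ^ 2) := mul_le_mul_of_nonneg_left hK (by positivity)
    have h2 : (1 + τ⁻¹) * (cK * τ ^ 2) = cK * τ ^ 2 + cK * τ := by field_simp
    have h3 : cK * τ ^ 2 ≤ cK * τ := by
      have hcK' : 0 ≤ cK := le_of_mul_le_mul_right (by rw [zero_mul]; exact hcK) (pow_pos hτ 2)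
      nlinarith
    linarith
  have e : ∀ c : ℝ, (1 + τ) • H' + c • G - Qfᵀ * H * Qf = ((1 + τ) • H' - Qfᵀ * H * Qf) + c • G := fun c => by abel
  rw [e] at h ⊢
  exact posSemidef_add_smul_of_le h hG hle

end Choice

/-! ## §2 The capstone under (STAB-ε,δ) -/

section Capstone

variable {c : Type*} [Fintype c] [DecidableEq c]
variable {ν : ℕ → Type*} [∀ k, Fintype (ν k)] [∀ k, DecidableEq (ν k)]
variable {H H₁ H₂ : ∀ k, Matrix (ν k) (ν k) ℝ} {Q Q₁ Q₂ : ∀ k, Matrix c (ν k) ℝ}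
variable {Qf : ∀ k, ℝ → ℝ → Matrix (ν k) (ν (k + 1)) ℝ} {P : ∀ k, ℝ → ℝ → Matrix (ν (k + 1)) (ν k) ℝ}
variable {G : ∀ k, ℝ → ℝ → Matrix (ν k) (ν k) ℝ}
variable {ρ s₁ B cst cε cδ N θ : ℝ}

/-- **`effForm_affine₂_step_rate_of_stabGram_of_cons` — (S1) PRODUCED UNDER (STAB-ε,δ)** [our proof; PART 20 BY NAME]: real affine two-bond towers
`(H_k + sH₁ₖ + tH₂ₖ, Q_k + sQ₁ₖ + tQ₂ₖ)` with one-step averagings `Qf_k(s,t)`, prolongations `P_k(s,t)` and symmetric mass forms `G_k(s,t)` such that at every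
real `(s,t) ∈ [0,s₁]²`: PSD fine forms, `Q_{k+1} = Q_k·Qf_k`, `Q_{k+1}·P_k = Q_k`, (STAB-ε_k,δ_k) `Qf_kᵀ H_k Qf_k ≤ (1 + cε·θ^k)·H_{k+1} + (cδ·θ^k)·G_{k+1}`,
(CONS) `≤ cst·θ^k`, `|(ℋ_kᵀ G_k ℋ_k)_{ab}| ≤ N`; S2: complexified bordered matrices nonsingular with `‖𝒮_k(z)_{ab}‖ ≤ B` on the bidisc (`0 < s₁`,
`s₁·cosh 1 < ρ`; `0 ≤ cε, cδ, θ`) ⟹ the complexified effective forms have the value rate `(cst + 2cε·B + 2cδ·N)·θ^k` on the real square. -/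
theorem effForm_affine₂_step_rate_of_stabGram_of_cons (hs₁ : 0 < s₁) (hs₁ρ : s₁ * Real.cosh 1 < ρ)
    (hdet : ∀ k, ∀ z ∈ ball (0 : ℂ) ρ ×ˢ ball (0 : ℂ) ρ,
      IsUnit (kkt ((H k).map Complex.ofRealHom + z.1 • (H₁ k).map Complex.ofRealHom + z.2 • (H₂ k).map Complex.ofRealHom)
        ((Q k).map Complex.ofRealHom + z.1 • (Q₁ k).map Complex.ofRealHom + z.2 • (Q₂ k).map Complex.ofRealHom)).det)
    (hB : ∀ k, ∀ z ∈ ball (0 : ℂ) ρ ×ˢ ball (0 : ℂ) ρ, ∀ a b : c,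
      ‖effForm ((H k).map Complex.ofRealHom + z.1 • (H₁ k).map Complex.ofRealHom + z.2 • (H₂ k).map Complex.ofRealHom)
        ((Q k).map Complex.ofRealHom + z.1 • (Q₁ k).map Complex.ofRealHom + z.2 • (Q₂ k).map Complex.ofRealHom) a b‖ ≤ B)
    (hH : ∀ k (s t : ℝ), 0 ≤ s → s ≤ s₁ → 0 ≤ t → t ≤ s₁ → (H k + s • H₁ k + t • H₂ k).PosSemidef)
    (hcomp : ∀ k (s t : ℝ), 0 ≤ s → s ≤ s₁ → 0 ≤ t → t ≤ s₁ →
      Q (k + 1) + s • Q₁ (k + 1) + t • Q₂ (k + 1) = (Q k + s • Q₁ k + t • Q₂ k) * Qf k s t)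
    (hPQ : ∀ k (s t : ℝ), 0 ≤ s → s ≤ s₁ → 0 ≤ t → t ≤ s₁ →
      (Q (k + 1) + s • Q₁ (k + 1) + t • Q₂ (k + 1)) * P k s t = Q k + s • Q₁ k + t • Q₂ k)
    (hG : ∀ k (s t : ℝ), (G k s t)ᵀ = G k s t) (hcε : 0 ≤ cε) (hcδ : 0 ≤ cδ) (hθ0 : 0 ≤ θ)
    (hstab : ∀ k (s t : ℝ), 0 ≤ s → s ≤ s₁ → 0 ≤ t → t ≤ s₁ →
      ((1 + cε * θ ^ k) • (H (k + 1) + s • H₁ (k + 1) + t • H₂ (k + 1)) + (cδ * θ ^ k) • G (k + 1) s t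
        - (Qf k s t)ᵀ * (H k + s • H₁ k + t • H₂ k) * Qf k s t).PosSemidef)
    (hcons : ∀ k (s t : ℝ), 0 ≤ s → s ≤ s₁ → 0 ≤ t → t ≤ s₁ → ∀ y : c,
      (minOp (H k + s • H₁ k + t • H₂ k) (Q k + s • Q₁ k + t • Q₂ k) *ᵥ Pi.single y 1) ⬝ᵥ
        (((P k s t)ᵀ * (H (k + 1) + s • H₁ (k + 1) + t • H₂ (k + 1)) * P k s t - (H k + s • H₁ k + t • H₂ k)) *ᵥ
          (minOp (H k + s • H₁ k + t • H₂ k) (Q k + s • Q₁ k + t • Q₂ k) *ᵥ Pi.single y 1)) ≤ cst * θ ^ k)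
    (hN : ∀ k (s t : ℝ), 0 ≤ s → s ≤ s₁ → 0 ≤ t → t ≤ s₁ → ∀ a b : c,
      |((minOp (H k + s • H₁ k + t • H₂ k) (Q k + s • Q₁ k + t • Q₂ k))ᵀ * G k s t
          * minOp (H k + s • H₁ k + t • H₂ k) (Q k + s • Q₁ k + t • Q₂ k)) a b| ≤ N)
    (a b : c) :
    ∀ k (s t : ℝ), 0 ≤ s → s ≤ s₁ → 0 ≤ t → t ≤ s₁ →
      ‖effForm ((H (k + 1)).map Complex.ofRealHom + (s : ℂ) • (H₁ (k + 1)).map Complex.ofRealHom + (t : ℂ) • (H₂ (k + 1)).map Complex.ofRealHom)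
            ((Q (k + 1)).map Complex.ofRealHom + (s : ℂ) • (Q₁ (k + 1)).map Complex.ofRealHom + (t : ℂ) • (Q₂ (k + 1)).map Complex.ofRealHom) a b
        - effForm ((H k).map Complex.ofRealHom + (s : ℂ) • (H₁ k).map Complex.ofRealHom + (t : ℂ) • (H₂ k).map Complex.ofRealHom)
            ((Q k).map Complex.ofRealHom + (s : ℂ) • (Q₁ k).map Complex.ofRealHom + (t : ℂ) • (Q₂ k).map Complex.ofRealHom) a b‖ ≤
        (cst + 2 * cε * B + 2 * cδ * N) * θ ^ k := by
  intro k s t hs0 hs1 ht0 ht1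
  have hs₁' : s₁ ≤ s₁ * Real.cosh 1 := le_mul_of_one_le_right hs₁.le (Real.one_le_cosh 1)
  have hmem : ((s : ℂ), (t : ℂ)) ∈ ball (0 : ℂ) ρ ×ˢ ball (0 : ℂ) ρ := by
    refine ⟨?_, ?_⟩
    · rw [mem_ball_zero_iff, Complex.norm_real, Real.norm_eq_abs, abs_of_nonneg hs0]; linarith
    · rw [mem_ball_zero_iff, Complex.norm_real, Real.norm_eq_abs, abs_of_nonneg ht0]; linarith
  have hreal : ∀ j, IsUnit (kkt (H j + s • H₁ j + t • H₂ j) (Q j + s • Q₁ j + t • Q₂ j)).det := fun j =>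
    isUnit_det_kkt_affine₂_real _ _ _ _ _ _ s t (hdet j ((s : ℂ), (t : ℂ)) hmem)
  have hBreal : ∀ j a b, |effForm (H j + s • H₁ j + t • H₂ j) (Q j + s • Q₁ j + t • Q₂ j) a b| ≤ B := fun j a b => by
    have h := hB j ((s : ℂ), (t : ℂ)) hmem a b
    rwa [effForm_affine₂_ofReal _ _ _ _ _ _ s t (hreal j), Complex.norm_real, Real.norm_eq_abs] at h
  have hrate := effForm_entry_step_rate_of_stabGram_of_cons
    (H := fun j => H j + s • H₁ j + t • H₂ j) (Qc := fun j => Q j + s • Q₁ j + t • Q₂ j)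
    (Qf := fun j => Qf j s t) (P := fun j => P j s t) (G := fun j => G j s t)
    (fun j => hH j s t hs0 hs1 ht0 ht1) hreal (fun j => hcomp j s t hs0 hs1 ht0 ht1) (fun j => hPQ j s t hs0 hs1 ht0 ht1)
    (fun j => hG j s t) hcε hcδ hθ0 (fun j => hstab j s t hs0 hs1 ht0 ht1) (fun j => hcons j s t hs0 hs1 ht0 ht1) hBreal
    (fun j => hN j s t hs0 hs1 ht0 ht1) k a b
  rw [effForm_affine₂_ofReal _ _ _ _ _ _ s t (hreal (k + 1)), effForm_affine₂_ofReal _ _ _ _ _ _ s t (hreal k),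
    ← Complex.ofReal_sub, Complex.norm_real, Real.norm_eq_abs]
  exact hrate

/-- **`dEffForm_step_rateω_of_stabGram_of_cons` — THE CAPSTONE UNDER (STAB-ε,δ)** [our proof; PART 13 + the previous theorem]: under the hypotheses of
`effForm_affine₂_step_rate_of_stabGram_of_cons` with `0 < cst`, `0 < θ`, `0 ≤ B`, `0 ≤ N`: for every `r ∈ ]0,1]` and `k`,
`‖dEffForm_{k+1} − dEffForm_k‖ ≤ 25·(2B)^r∕(s₁r²)·(cst + 2cε·B + 2cδ·N)^{1−r}·(θ^{1−r})^k` (complexified letters; first bond direction). -/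
theorem dEffForm_step_rateω_of_stabGram_of_cons (hs₁ : 0 < s₁) (hs₁ρ : s₁ * Real.cosh 1 < ρ)
    (hdet : ∀ k, ∀ z ∈ ball (0 : ℂ) ρ ×ˢ ball (0 : ℂ) ρ,
      IsUnit (kkt ((H k).map Complex.ofRealHom + z.1 • (H₁ k).map Complex.ofRealHom + z.2 • (H₂ k).map Complex.ofRealHom)
        ((Q k).map Complex.ofRealHom + z.1 • (Q₁ k).map Complex.ofRealHom + z.2 • (Q₂ k).map Complex.ofRealHom)).det)
    (hB : ∀ k, ∀ z ∈ ball (0 : ℂ) ρ ×ˢ ball (0 : ℂ) ρ, ∀ a b : c,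
      ‖effForm ((H k).map Complex.ofRealHom + z.1 • (H₁ k).map Complex.ofRealHom + z.2 • (H₂ k).map Complex.ofRealHom)
        ((Q k).map Complex.ofRealHom + z.1 • (Q₁ k).map Complex.ofRealHom + z.2 • (Q₂ k).map Complex.ofRealHom) a b‖ ≤ B)
    (hH : ∀ k (s t : ℝ), 0 ≤ s → s ≤ s₁ → 0 ≤ t → t ≤ s₁ → (H k + s • H₁ k + t • H₂ k).PosSemidef)
    (hcomp : ∀ k (s t : ℝ), 0 ≤ s → s ≤ s₁ → 0 ≤ t → t ≤ s₁ →
      Q (k + 1) + s • Q₁ (k + 1) + t • Q₂ (k + 1) = (Q k + s • Q₁ k + t • Q₂ k) * Qf k s t)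
    (hPQ : ∀ k (s t : ℝ), 0 ≤ s → s ≤ s₁ → 0 ≤ t → t ≤ s₁ →
      (Q (k + 1) + s • Q₁ (k + 1) + t • Q₂ (k + 1)) * P k s t = Q k + s • Q₁ k + t • Q₂ k)
    (hG : ∀ k (s t : ℝ), (G k s t)ᵀ = G k s t) (hcε : 0 ≤ cε) (hcδ : 0 ≤ cδ) (hB0 : 0 ≤ B) (hN0 : 0 ≤ N)
    (hstab : ∀ k (s t : ℝ), 0 ≤ s → s ≤ s₁ → 0 ≤ t → t ≤ s₁ →
      ((1 + cε * θ ^ k) • (H (k + 1) + s • H₁ (k + 1) + t • H₂ (k + 1)) + (cδ * θ ^ k) • G (k + 1) s t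
        - (Qf k s t)ᵀ * (H k + s • H₁ k + t • H₂ k) * Qf k s t).PosSemidef)
    (hcons : ∀ k (s t : ℝ), 0 ≤ s → s ≤ s₁ → 0 ≤ t → t ≤ s₁ → ∀ y : c,
      (minOp (H k + s • H₁ k + t • H₂ k) (Q k + s • Q₁ k + t • Q₂ k) *ᵥ Pi.single y 1) ⬝ᵥ
        (((P k s t)ᵀ * (H (k + 1) + s • H₁ (k + 1) + t • H₂ (k + 1)) * P k s t - (H k + s • H₁ k + t • H₂ k)) *ᵥ
          (minOp (H k + s • H₁ k + t • H₂ k) (Q k + s • Q₁ k + t • Q₂ k) *ᵥ Pi.single y 1)) ≤ cst * θ ^ k)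
    (hN : ∀ k (s t : ℝ), 0 ≤ s → s ≤ s₁ → 0 ≤ t → t ≤ s₁ → ∀ a b : c,
      |((minOp (H k + s • H₁ k + t • H₂ k) (Q k + s • Q₁ k + t • Q₂ k))ᵀ * G k s t
          * minOp (H k + s • H₁ k + t • H₂ k) (Q k + s • Q₁ k + t • Q₂ k)) a b| ≤ N)
    (hc : 0 < cst) (hθ : 0 < θ) {r : ℝ} (hr : 0 < r) (hr1 : r ≤ 1) (k : ℕ) (a b : c) :
    ‖dEffForm ((H (k + 1)).map Complex.ofRealHom) ((Q (k + 1)).map Complex.ofRealHom) ((H₁ (k + 1)).map Complex.ofRealHom)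
          ((Q₁ (k + 1)).map Complex.ofRealHom) a b
        - dEffForm ((H k).map Complex.ofRealHom) ((Q k).map Complex.ofRealHom) ((H₁ k).map Complex.ofRealHom)
          ((Q₁ k).map Complex.ofRealHom) a b‖ ≤
      25 * (2 * B) ^ r / (s₁ * r ^ 2) * (cst + 2 * cε * B + 2 * cδ * N) ^ (1 - r) * (θ ^ (1 - r)) ^ k := by
  have hc' : 0 < cst + 2 * cε * B + 2 * cδ * N := by positivity
  exact dEffForm_step_rateω (μ := fun _ => c) (i := fun _ => a) (j := fun _ => b)
    (H := fun k => (H k).map Complex.ofRealHom) (H₁ := fun k => (H₁ k).map Complex.ofRealHom)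
    (H₂ := fun k => (H₂ k).map Complex.ofRealHom) (Q := fun k => (Q k).map Complex.ofRealHom)
    (Q₁ := fun k => (Q₁ k).map Complex.ofRealHom) (Q₂ := fun k => (Q₂ k).map Complex.ofRealHom)
    hs₁ hs₁ρ hdet (fun k z hz => hB k z hz a b)
    (effForm_affine₂_step_rate_of_stabGram_of_cons hs₁ hs₁ρ hdet hB hH hcomp hPQ hG hcε hcδ hθ.le hstab hcons hN a b)
    hc' hθ hr hr1 k

end Capstone

end Summit.QuantumFields.BalabanUV.Beta.GAN24.DerivativeRateTransferLoewnerGramEnd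

end
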